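import Literature.AlgebraicGeometry.HodgeTheory.WeilClassesLocalAnchor
import Literature.AlgebraicGeometry.HodgeTheory.WeilFamilyFlatSections
import Literature.AlgebraicGeometry.Motives.AbelianVarietyProduct
import Literature.AlgebraicGeometry.HodgeTheory.ComplexConjugationHolds
import HarnessLib

/-!
# Locally algebraic TENSOR anchors: the local predicate for Deligne's family through an arbitrary Weil-type abelian variety

Family `hodge`, layer `Literature/AlgebraicGeometry/HodgeTheory`. One PREDICATE (real definition), no named fact.
Companion of `HasLocallyAlgebraicWeilAnchor` (`WeilClassesLocalAnchor.lean`: ONE hyperbolic anchor; composes with the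
reach fact `weilFamilyReach_hyperbolic`, hence reaches only the SPLIT component). The tree's other Weil-family fact,
`deligne1982_weilFamily_hodgeWeilSection` (`WeilFamilyFlatSections.lean`; Deligne, LNM 900, proof of Thm. 4.8 (a)–(c):
for `p ≡ 3 (4)`, `p ≥ 7`, `K = ℚ(√-p)`), runs Deligne's PEL family THROUGH AN ARBITRARY Weil-type `(X, Φ)` — of ANY
discriminant — with a flat `(k,k)` Weil section through any non-zero Weil class of `X`, and exhibits on the same base
a TENSOR POINT: a fibre `Y` carrying a `K`-equivariant isogeny pair towards `(A₁ × A₁, Ψ₀)`,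
`Ψ₀ = prodLift (snd ≫ (-p)) fst` (on the SPLIT components Deligne's `A₀ ⊗ K` itself, Thm. 4.8 (b) — equivalently
[Andre1996Motifs, Lemme 6.3.3], split case; in EVERY component the diagonal CM member `E_K^k(ι) × E_K^k(ῑ)` of van
Geemen's family [vanGeemen1994HodgeAV, 5.3–5.7] — `V₊ := span(e₁, …, e_k)` in the basis (5.4.1), a routine step not
printed as such, spelled out in the module docstring of `WeilFamilyFlatSections.lean` (packet G19) — which is
`K`-isogenous to `E_K^k ⊗ ℤ[√-p] = (E_K^k × E_K^k, Ψ₀)`, `A₁ = E_K^k`). So no REACH statement and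
no discriminant on the carriers are needed to cover the NON-split components: it suffices that the Weil section be
algebraic on a neighbourhood of the tensor point — for EVERY tensor point the fact may produce. This file states that
requirement as a predicate:

* `HasLocallyAlgebraicTensorAnchors k p`: for every abelian `2k`-fold `(Y, Ψ)`, `Ψ ≫ Ψ = -p`, with an isogeny pair
  towards a tensor point `(A₁ × A₁, Ψ₀)` (the fact's clause, verbatim), every rational class `x` of its Weil plane,
  every smooth projective family `f : 𝒳 ⟶ S` of abelian `2k`-folds with `ℤ[√-p]`-action (quasi-projective total space,
  smooth irreducible quasi-projective base), every global `W ∈ H^{2k}(𝒳)` with rational `(k,k)` fibre restrictions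
  and every chart `e₀ : Y ≅ 𝒳_{s₀}` with `e₀^*(W|_{𝒳_{s₀}}) = x`: there are an OPEN `U ∋ s₀`, a global class
  `H ∈ H²(𝒳)` with rational `(1,1)` fibre restrictions and `q ∈ ℚ` with `q·H_sᵏ + W_s` algebraic on `𝒳_s` for all
  `s ∈ U`. (The polarization class is existential here because the fact does not output one; `H = 0`, `q = 0` is
  allowed — the shape of a WEIL-PURE anchor object, `ch(E₀) = r₀ + r·x`, of the line `quaternionic-norm-anchors` of
  crux `HeckePrymWeil.WeilTenfoldsSqrtMinus11`, whose `stub_perryRouteCompositionFull` is the object-level instance.)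

Summit-side (`Summits/HodgeConjecture/HodgeConjecture/Theorems/WeilTypeLadderTensorLocalAnchor.lean`):
`deligne1982_weilFamily_hodgeWeilSection ∧ HasLocallyAlgebraicTensorAnchors k p ⟹` every rational `(k,k)` Weil class
of EVERY `(X, Φ)` of dimension `2k` with `Φ ≫ Φ = -p` is algebraic — all discriminants, in particular the NON-SPLIT
sixfolds at `k = 3` (crux `WeilSixfoldsSqrtMinus7` at `p = 7`) — by the W-engine, rationality along the section, the
local clause at the tensor point, Baire / countable union, and Lefschetz on `X` itself (the family passes through `X`:
no isogeny transfer, no one-class-suffices). Under the Hodge conjecture the predicate holds trivially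
(`localTensorClause_of_forall_mem_algebraicClasses`).

## References
* [Deligne1982HodgeCycles] P. Deligne, Hodge cycles on abelian varieties, LNM 900 (1982), proof of Thm. 4.8 (a)–(c),
  Prop. 4.4 (the family; its tensor point `A₀ ⊗ K` on the split components).
* [vanGeemen1994HodgeAV] B. van Geemen, An introduction to the Hodge conjecture for abelian varieties, LNM 1594 (1994),
  5.3–5.7 (the family in every component; the diagonal CM member via `V₊ = span(e₁, …, e_k)` of (5.4.1)).
* [Andre1996Motifs] Y. André, Publ. Math. IHÉS 83 (1996), Lemme 6.3.3 (split case).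
* [BuchweitzFlenner2003] R.-O. Buchweitz, H. Flenner, Compositio Math. 137 (2003), Thm. 5.1 (local output shape).
* [Markman2025SecantWeil] E. Markman, arXiv:2502.03415, §1.5 (local deformation of a `κ`-class; shape `q·hᵏ + w`).
-/

noncomputable section

open CategoryTheory

namespace Literature.AlgebraicGeometry.HodgeTheory

open Literature.AlgebraicTopology.SingularHomology

section HodgeTheory

/-- **Locally algebraic TENSOR anchors in dimension `2k` for `K = ℚ(√-p)`.** For EVERY complex abelian `2k`-fold
`(Y, Ψ)` with `Ψ ≫ Ψ = -p` carrying an isogeny pair `f₁ : Y ⟶ A₁ × A₁`, `g₁ : A₁ × A₁ ⟶ Y` (`f₁ ≫ g₁ = m`, `f₁` flat,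
`g₁` intertwining `Ψ` with Deligne's `Ψ₀ = prodLift (snd ≫ (-p)) fst`, `dim A₁ = k` — the tensor-point clause of
`deligne1982_weilFamily_hodgeWeilSection`), every RATIONAL class `x` of `weilClassesOf Y Ψ k p`, every smooth projective
family `f : 𝒳 ⟶ S` of relative dimension `2k` (`𝒳`, `S` quasi-projective, `S` smooth irreducible) all of whose fibres
are abelian `2k`-folds with an endomorphism of square `-p`, every global class `W ∈ H^{2k}(𝒳(ℂ); ℂ)` with rational
`(k,k)` fibre restrictions, every complex point `s₀` and chart `e₀ : Y.X ≅ 𝒳_{s₀}` with `e₀^*(W|_{𝒳_{s₀}}) = x`: there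
are an open `U ∋ s₀` in `S(ℂ)`, a global `H ∈ H²(𝒳(ℂ); ℂ)` with rational `(1,1)` fibre restrictions and `q ∈ ℚ` with
`q·(H|_{𝒳_s})ᵏ + W|_{𝒳_s} ∈ algebraicClasses (𝒳_s) k` for every `s ∈ U`. (Local output of a semiregularity theorem at
an anchor object on a tensor point; module docstring. Provenance of the tensor points, packet G19: Deligne 4.8 (b) /
André 6.3.3 on the split components, van Geemen 5.3–5.7 with `V₊ = span(e₁, …, e_k)` of (5.4.1) in every component.)
[cite: Deligne1982HodgeCycles, proof of Thm. 4.8 (a)–(c)]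
[cite: vanGeemen1994HodgeAV, §5.3–5.7 (every component; diagonal CM member via V₊ = span(e₁..e_k) of (5.4.1))]
[cite: BuchweitzFlenner2003, Thm. 5.1] -/
def HasLocallyAlgebraicTensorAnchors (k p : ℕ) : Prop :=
  ∀ (Y : Motives.AbelianVariety ℂ) (Ψ : Y ⟶ Y), Y.dim = 2 * k → Ψ ≫ Ψ = -((p : ℤ) • 𝟙 Y) →
    (∃ (A₁ : Motives.AbelianVariety ℂ) (f₁ : Y ⟶ A₁.prod A₁) (g₁ : A₁.prod A₁ ⟶ Y) (m : ℕ),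
      A₁.dim = k ∧ 0 < m ∧ f₁ ≫ g₁ = m • 𝟙 Y ∧ AlgebraicGeometry.Flat f₁.hom.hom.hom.left ∧
      g₁ ≫ Ψ = Motives.AbelianVariety.prodLift
        (Motives.AbelianVariety.snd A₁ A₁ ≫ (-((p : ℤ) • 𝟙 A₁))) (Motives.AbelianVariety.fst A₁ A₁) ≫ g₁) →
    ∀ (x : complexBetti Y.X (2 * k)), x ∈ weilClassesOf Y Ψ k p → IsRationalClass x →
    ∀ ⦃𝒳 S : Motives.SchemeOver ℂ⦄ (f : 𝒳 ⟶ S), Motives.IsSmoothProjectiveFamily f (2 * k) →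
      IsQuasiProjectiveOver 𝒳 → IsQuasiProjectiveOver S → IrreducibleSpace S.left →
      AlgebraicGeometry.Smooth S.hom →
      (∀ s : Motives.ComplexPoints S, ∃ (A' : Motives.AbelianVariety ℂ) (φ' : A' ⟶ A'),
          A'.dim = 2 * k ∧ φ' ≫ φ' = -((p : ℤ) • 𝟙 A') ∧ Nonempty (A'.X ≅ Motives.fiberOver f s)) →
      ∀ (W : complexBetti 𝒳 (2 * k)),
        (∀ s : Motives.ComplexPoints S,
          IsRationalClass (complexBetti.map (Motives.fiberι f s) (2 * k) W) ∧
            IsOfHodgeType (2 * k) (Motives.fiberOver f s) (2 * k) k k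
              (complexBetti.map (Motives.fiberι f s) (2 * k) W)) →
        ∀ (s₀ : Motives.ComplexPoints S) (e₀ : Y.X ≅ Motives.fiberOver f s₀),
          complexBetti.map e₀.hom (2 * k) (complexBetti.map (Motives.fiberι f s₀) (2 * k) W) = x →
          ∃ (U : Set (Motives.ComplexPoints S)) (H : complexBetti 𝒳 2) (q : ℚ), IsOpen U ∧ s₀ ∈ U ∧
            (∀ s : Motives.ComplexPoints S,
              IsRationalClass (complexBetti.map (Motives.fiberι f s) 2 H) ∧
                IsOfHodgeType (2 * k) (Motives.fiberOver f s) 2 1 1 (complexBetti.map (Motives.fiberι f s) 2 H)) ∧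
            ∀ s ∈ U, ((q : ℚ) : ℂ) • cupPowTwo (complexBetti.map (Motives.fiberι f s) 2 H) k +
              complexBetti.map (Motives.fiberι f s) (2 * k) W ∈ algebraicClasses (Motives.fiberOver f s) k

/-- **Global algebraicity gives the local tensor clause** (sanity; e.g. under `HodgeConjectureFor` on all fibres):
take `U = S(ℂ)`, `H = 0`, `q = 0`. [folklore] -/
theorem localTensorClause_of_forall_mem_algebraicClasses {k : ℕ} {𝒳 S : Motives.SchemeOver ℂ} (f : 𝒳 ⟶ S)
    (hf : Motives.IsSmoothProjectiveFamily f (2 * k)) (W : complexBetti 𝒳 (2 * k)) (s₀ : Motives.ComplexPoints S)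
    (hW : ∀ s : Motives.ComplexPoints S,
      complexBetti.map (Motives.fiberι f s) (2 * k) W ∈ algebraicClasses (Motives.fiberOver f s) k) :
    ∃ (U : Set (Motives.ComplexPoints S)) (H : complexBetti 𝒳 2) (q : ℚ), IsOpen U ∧ s₀ ∈ U ∧
      (∀ s : Motives.ComplexPoints S,
        IsRationalClass (complexBetti.map (Motives.fiberι f s) 2 H) ∧
          IsOfHodgeType (2 * k) (Motives.fiberOver f s) 2 1 1 (complexBetti.map (Motives.fiberι f s) 2 H)) ∧
      ∀ s ∈ U, ((q : ℚ) : ℂ) • cupPowTwo (complexBetti.map (Motives.fiberι f s) 2 H) k +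
        complexBetti.map (Motives.fiberι f s) (2 * k) W ∈ algebraicClasses (Motives.fiberOver f s) k := by
  refine ⟨Set.univ, 0, 0, isOpen_univ, Set.mem_univ _, fun s => ?_, fun s _ => ?_⟩
  · rw [map_zero]
    exact ⟨IsRationalClass.zero,
      isOfHodgeType_zero_of_isSmoothProjective nonempty_hodgeModel_holds (hf.isSmoothProjective s) _ _ _⟩
  · rw [Rat.cast_zero, zero_smul, zero_add]
    exact hW s

end HodgeTheory

end Literature.AlgebraicGeometry.HodgeTheory

end
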